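import Mathlib
import HarnessLib
import Summits.FinalStateConjecture.FinalStateConjecture.Theorems.LogTimeThreeAnnuliDyadicCaptureDefs
import Summits.FinalStateConjecture.FinalStateConjecture.Theorems.LogTimeThreeAnnuliDyadicCaptureRestrictionRechartAux
import Summits.FinalStateConjecture.FinalStateConjecture.Theorems.LogTimeThreeAnnuliDyadicCaptureHorizonNormalisedRestrictionAlgebra
import Literature.Geometry.Lorentzian.KerrCollarConvergence
import Literature.Geometry.Lorentzian.KerrConvergenceProofs

/-!
# Route LogTimeThreeAnnuli · crux `DyadicCapture`, line `registered` — stub 6b': the relabel rechart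

Proof of the registered stub `stub_relabelRechart` (6b') of the skeleton of the crux
`Summit.FinalStateConjecture.FinalStateConjecture.Theses.LogTimeThreeAnnuli.DyadicCapture`
(stmt-FinalStateConjecture-17488, line `registered`, file `Cruxes/DyadicCapture/Lines/birth.lean`).

Given an honest era system `d, R` (`IsHonestEraSystem`) of the MGHD `𝒟` with frozen `Cᵏ` convergence
(`HasFrozenConvergence`) to sub-extremal members `(Mᵢ, aᵢ)` in the REFERENCE charts, and the conclusion of
horizon rigidity (stub 6a, `stub_horizonRigidity`): `Mᵢ = d.mass i` and `|aᵢ| = |d.spin i|`, we CONSTRUCT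
the settled system (`IsSettledSystem`) on the SAME region `O' := O`. Since the Kerr–Schild radius `r_a`
and the horizon radius `r₊(M, a)` depend on the spin through `a²` only
(`horizonRestriction_kerrSchild_eq_of_abs_eq`), the frozen exteriors EQUAL the reference domains,
`boostedKerrExterior Λᵢ cᵢ Mᵢ aᵢ = boostedKerrExterior Λᵢ cᵢ (d.mass i) (d.spin i)`, and the frozen radius
function is the reference one. The `C²` `FinalStateDecomposition d'` has masses/spins `(Mᵢ, aᵢ)` (the
spin sign may flip per hole), the same motions, late time `d.τ₀`, excision radii, flat domain and flat
chart, and hole charts `d.chart i ∘ Opens.inclusion (le_of_eq …)` (the reference charts re-typed along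
the equality of `Opens E4`, no casts). The inclusion between EQUAL opens is a bijection, so the images of
late regions, slabs, truncated slabs, truncated world-tubes and growing near zones of the re-typed charts
are those of the reference charts (`relabelRechart_image_comp_inclusion` and its specialisations);
hence `d'.charted = d.charted`, `certifiedLate d' R = d.certifiedLate R`, `certifiedSlab d' R =
d.certifiedSlab R`, separation and the covering clause are those of `d`, and the truncated `Cᵏ`
deviations of the re-typed charts from the frozen boosted Kerr–Schild forms are at most the frozen
deviations in the reference charts (`Spacetime.truncDeviationCk_comp_inclusion_le`, same time and radius
functions), so fixed-slab and growing-slab convergence at `k = 2` (radii `R` verbatim) follow from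
`HasFrozenConvergence`; the covector clause transfers by the chain rule along the inclusion
(`restrictionRechart_mfderiv_comp_inclusion_apply`). The case `aᵢ = d.spin i` is the landed
`dyadicCapture_honestRechart_of_sameParams`. Sources: Dafermos–Luk arXiv:1710.01722, Conjecture 1
(b)–(c); DHRT arXiv:2104.08222, §1; O'Neill 1995, Ch. 2, §2.3 (`r₊ = M + √(M² − a²)`); Klainerman–Szeftel,
AMS-210, §1.2 (orbital versus asymptotic stability in a fixed gauge).
-/

-- the `Summit.FinalStateConjecture.FinalStateConjecture.…` namespace repeats the summit = sub-problem
-- segment (D-0017 layout, CONVENTIONS §2); the duplicate is deliberate.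
set_option linter.dupNamespace false

noncomputable section

namespace Summit.FinalStateConjecture.FinalStateConjecture.Theorems

open Literature.Geometry.Lorentzian
open scoped Topology Manifold ENNReal ContDiff
open Filter Set TopologicalSpace

/-! ### Images along the inclusion between equal open subsets of `E4` -/

/-- **The inclusion between EQUAL open subsets of `E4` is a bijection on images**: if `U ≤ V` and
`V ≤ U`, then for `f : V → X` and sets `S ⊆ U`, `T ⊆ V` with the same underlying membership condition,
`(f ∘ ι) '' S = f '' T` (`Set.image_comp`; the inverse inclusion provides the preimages). [folklore] -/
theorem relabelRechart_image_comp_inclusion {U V : Opens E4} (h : U ≤ V) (h' : V ≤ U) {X : Type*}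
    (f : V → X) (S : Set U) (T : Set V) (hST : ∀ x : V, Opens.inclusion h' x ∈ S ↔ x ∈ T) :
    (f ∘ Opens.inclusion h) '' S = f '' T := by
  rw [Set.image_comp]
  congr 1
  ext x
  constructor
  · rintro ⟨y, hy, rfl⟩
    exact (hST _).1 hy
  · intro hx
    exact ⟨Opens.inclusion h' x, (hST x).2 hx, rfl⟩

section EqualExteriors

variable (Λ : lorentzGroup) (c : E4) (M₁ a₁ M₂ a₂ : ℝ)
  (h : boostedKerrExterior Λ c M₁ a₁ ≤ boostedKerrExterior Λ c M₂ a₂)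
  (h' : boostedKerrExterior Λ c M₂ a₂ ≤ boostedKerrExterior Λ c M₁ a₁)
  {X : Type*} (f : boostedKerrExterior Λ c M₂ a₂ → X)
include h'

/-- Along the inclusion between equal boosted exteriors with the same motion, the late image
`{t* > τ}` of the re-typed chart `f ∘ ι` is the late image of `f` (same rest-frame time
`(Λ⁻¹(x − c))⁰`; DHRT arXiv:2104.08222, §1 for the late region). [folklore] -/
theorem relabelRechart_image_lateRegion (τ : ℝ) :
    (f ∘ Opens.inclusion h) '' (boostedKerrBackground Λ c M₁ a₁).lateRegion τ =
      f '' (boostedKerrBackground Λ c M₂ a₂).lateRegion τ :=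
  relabelRechart_image_comp_inclusion h h' f _ _ fun _ ↦ Iff.rfl

/-- Along the inclusion between equal boosted exteriors with the same motion, the image of the slab
`{t* = τ}` of the re-typed chart is that of `f`. [folklore] -/
theorem relabelRechart_image_timeSlab (τ : ℝ) :
    (f ∘ Opens.inclusion h) '' (boostedKerrBackground Λ c M₁ a₁).timeSlab τ =
      f '' (boostedKerrBackground Λ c M₂ a₂).timeSlab τ :=
  relabelRechart_image_comp_inclusion h h' f _ _ fun _ ↦ Iff.rfl

variable (hr : Kerr.radius a₁ = Kerr.radius a₂)
include hr

/-- Along the inclusion between equal boosted exteriors with the same motion and the same Kerr–Schild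
radius function (`r_{a₁} = r_{a₂}`, e.g. `|a₁| = |a₂|`), the image of the truncated slab
`{t* = τ, r ≤ ρ}` of the re-typed chart is that of `f`. [folklore] -/
theorem relabelRechart_image_truncTimeSlab (ρ τ : ℝ) :
    (f ∘ Opens.inclusion h) '' (boostedKerrBackground Λ c M₁ a₁).truncTimeSlab ρ τ =
      f '' (boostedKerrBackground Λ c M₂ a₂).truncTimeSlab ρ τ :=
  relabelRechart_image_comp_inclusion h h' f _ _ fun x ↦ by
    show poincareInv Λ c x.1 0 = τ ∧ Kerr.radius a₁ (poincareInv Λ c x.1) ≤ ρ ↔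
      poincareInv Λ c x.1 0 = τ ∧ Kerr.radius a₂ (poincareInv Λ c x.1) ≤ ρ
    rw [hr]

/-- Along the inclusion between equal boosted exteriors with the same motion and radius function, the
image of the truncated world-tube `{t* > τ, r ≤ ρ}` of the re-typed chart is that of `f`. [folklore] -/
theorem relabelRechart_image_truncLateRegion (τ ρ : ℝ) :
    (f ∘ Opens.inclusion h) '' (boostedKerrBackground Λ c M₁ a₁).truncLateRegion τ ρ =
      f '' (boostedKerrBackground Λ c M₂ a₂).truncLateRegion τ ρ :=
  relabelRechart_image_comp_inclusion h h' f _ _ fun x ↦ by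
    show τ < poincareInv Λ c x.1 0 ∧ Kerr.radius a₁ (poincareInv Λ c x.1) ≤ ρ ↔
      τ < poincareInv Λ c x.1 0 ∧ Kerr.radius a₂ (poincareInv Λ c x.1) ≤ ρ
    rw [hr]

/-- Along the inclusion between equal boosted exteriors with the same motion and radius function, the
image of the growing near zone `{t* > τ, r ≤ R(t*)}` of the re-typed chart is that of `f` (the hole
pieces of `certifiedLate`). [folklore] -/
theorem relabelRechart_image_certified (R : ℝ → ℝ) (τ : ℝ) :
    (f ∘ Opens.inclusion h) ''
        {x | τ < (boostedKerrBackground Λ c M₁ a₁).time x.1 ∧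
          (boostedKerrBackground Λ c M₁ a₁).radius x.1 ≤
            R ((boostedKerrBackground Λ c M₁ a₁).time x.1)} =
      f '' {x | τ < (boostedKerrBackground Λ c M₂ a₂).time x.1 ∧
        (boostedKerrBackground Λ c M₂ a₂).radius x.1 ≤
          R ((boostedKerrBackground Λ c M₂ a₂).time x.1)} :=
  relabelRechart_image_comp_inclusion h h' f _ _ fun x ↦ by
    show τ < poincareInv Λ c x.1 0 ∧ Kerr.radius a₁ (poincareInv Λ c x.1) ≤ R (poincareInv Λ c x.1 0) ↔
      τ < poincareInv Λ c x.1 0 ∧ Kerr.radius a₂ (poincareInv Λ c x.1) ≤ R (poincareInv Λ c x.1 0)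
    rw [hr]

end EqualExteriors

/-! ### The relabel rechart -/

/-- **Stub 6b' — the relabel rechart** of the line `registered` of the crux `DyadicCapture`: under
horizon rigidity (`Mᵢ = d.mass i`, `|aᵢ| = |d.spin i|`) the frozen exteriors equal the reference domains,
so the reference charts of an honest era system with frozen convergence — re-typed along
`Opens.inclusion (le_of_eq …)`, spins relabelled to `aᵢ`, late time `d.τ₀`, radii `R`, excision radii and
flat data verbatim — form a `C²` `FinalStateDecomposition d'` of the SAME `O` which is a settled system
(`IsSettledSystem`): `d'.charted = d.charted`, the certified sets agree, convergence transfers along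
`Spacetime.truncDeviationCk_comp_inclusion_le`, the covector clause along the chain rule.
Dafermos–Luk arXiv:1710.01722, Conjecture 1 (b)–(c). [cite: DafermosLuk2017, Conjecture 1 (b)–(c)] -/
theorem stub_relabelRechart : ∀ (X : Type) [TopologicalSpace X] [ChartedSpace E3 X] [IsManifold (𝓡 3) ((⊤ : ℕ∞) : WithTop ℕ∞) X] [T2Space X] [SecondCountableTopology X] [ConnectedSpace X], ∀ D ∈ admissibleVacuumData X, ∀ 𝒟 : VacuumCauchyDevelopment D, 𝒟.IsMaximal → Summit.FinalStateConjecture.HasCompleteNullInfinity 𝒟.toCauchyDevelopment → ∀ (O : Set 𝒟.carrier) (d : QuasiFinalStateDecomposition 𝒟.toSpacetime O 2 ⊤) (R : Fin d.N → ℝ → ℝ) (M a : Fin d.N → ℝ), Summit.FinalStateConjecture.FinalStateConjecture.Theorems.IsHonestEraSystem 𝒟 O d R → (∀ i : Fin d.N, 0 < M i ∧ |a i| < M i) → Summit.FinalStateConjecture.FinalStateConjecture.Theorems.HasFrozenConvergence 𝒟.toSpacetime O d R M a → (∀ i : Fin d.N, M i = d.mass i ∧ |a i| = |d.spin i|) →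 ∃ (O' : Set 𝒟.carrier) (d' : FinalStateDecomposition 𝒟.toSpacetime O' 2), Summit.FinalStateConjecture.FinalStateConjecture.Theorems.IsSettledSystem 𝒟 O' d' := by
  intro X _ _ _ _ _ _ D _ 𝒟 _ _ O d R M a hera hsub hfro hrig
  obtain ⟨hO, hrays, hR, hexh, horth, hcov, hflat0, hflat⟩ := hera
  obtain ⟨hfix, hgrow⟩ := hfro
  -- Kerr–Schild algebra: radius functions, horizon radii and exteriors depend on `a²` only
  have hrad : ∀ i : Fin d.N, Kerr.radius (a i) = Kerr.radius (d.spin i) := fun i ↦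
    horizonRestriction_radius_eq_of_abs_eq (hrig i).2
  have hradx : ∀ (i : Fin d.N) (y : E4), Kerr.radius (a i) y = Kerr.radius (d.spin i) y :=
    fun i y ↦ congrFun (hrad i) y
  have hrp : ∀ i : Fin d.N, Kerr.rPlus (M i) (a i) = Kerr.rPlus (d.mass i) (d.spin i) := fun i ↦ by
    rw [(hrig i).1]
    exact horizonRestriction_rPlus_eq_of_abs_eq _ (hrig i).2
  have hdom : ∀ i : Fin d.N, boostedKerrExterior (d.motion i).1 (d.motion i).2 (M i) (a i) =
      boostedKerrExterior (d.motion i).1 (d.motion i).2 (d.mass i) (d.spin i) := fun i ↦ by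
    rw [(hrig i).1]
    exact (horizonRestriction_kerrSchild_eq_of_abs_eq _ _ _ _ _ (hrig i).2).2.2.2
  have hle : ∀ i : Fin d.N, boostedKerrExterior (d.motion i).1 (d.motion i).2 (M i) (a i) ≤
      boostedKerrExterior (d.motion i).1 (d.motion i).2 (d.mass i) (d.spin i) := fun i ↦ (hdom i).le
  have hge : ∀ i : Fin d.N, boostedKerrExterior (d.motion i).1 (d.motion i).2 (d.mass i) (d.spin i) ≤
      boostedKerrExterior (d.motion i).1 (d.motion i).2 (M i) (a i) := fun i ↦ (hdom i).ge
  -- (1) the re-typed hole charts are late-time charts into `O` after `d.τ₀`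
  have hlate : ∀ i : Fin d.N, 𝒟.toSpacetime.IsLateChart
      (boostedKerrBackground (d.motion i).1 (d.motion i).2 (M i) (a i)) O d.τ₀
      (d.chart i ∘ Opens.inclusion (hle i)) := fun i ↦
    (d.isLateChart i).comp_inclusion
      (B' := boostedKerrBackground (d.motion i).1 (d.motion i).2 (M i) (a i)) (hle i) fun _ ↦ rfl
  -- (2) the truncated deviations of the re-typed charts are at most the frozen ones
  have hdev : ∀ (i : Fin d.N) (k : ℕ) (ρ τ : ℝ), 𝒟.toSpacetime.truncDeviationCk
      (boostedKerrBackground (d.motion i).1 (d.motion i).2 (M i) (a i))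
      (d.chart i ∘ Opens.inclusion (hle i)) k ρ τ ≤
      𝒟.toSpacetime.truncDeviationCk {d.background i with
        bilin := boostedKerrBilin (d.motion i).1 (d.motion i).2 (M i) (a i)} (d.chart i) k ρ τ :=
    fun i k ρ τ ↦ 𝒟.toSpacetime.truncDeviationCk_comp_inclusion_le
      (B := {d.background i with bilin := boostedKerrBilin (d.motion i).1 (d.motion i).2 (M i) (a i)})
      (B' := boostedKerrBackground (d.motion i).1 (d.motion i).2 (M i) (a i)) (hle i)
      (fun _ ↦ rfl) (fun _ ↦ rfl)
      (fun x ↦ by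
        show Kerr.radius (a i) (poincareInv (d.motion i).1 (d.motion i).2 x.1) =
          Kerr.radius (d.spin i) (poincareInv (d.motion i).1 (d.motion i).2 x.1)
        rw [hrad i])
      (d.isLateChart i).contMDiff k ρ τ
  have htrunc : ∀ (i : Fin d.N) (ρ : ℝ), Tendsto (fun τ ↦ 𝒟.toSpacetime.truncDeviationCk
      (boostedKerrBackground (d.motion i).1 (d.motion i).2 (M i) (a i))
      (d.chart i ∘ Opens.inclusion (hle i)) 2 ρ τ) atTop (𝓝 0) := fun i ρ ↦
    tendsto_of_tendsto_of_tendsto_of_le_of_le tendsto_const_nhds (hfix i 2 ρ) (fun _ ↦ zero_le)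
      fun τ ↦ hdev i 2 ρ τ
  have hgrow' : ∀ i : Fin d.N, Tendsto (fun τ ↦ 𝒟.toSpacetime.truncDeviationCk
      (boostedKerrBackground (d.motion i).1 (d.motion i).2 (M i) (a i))
      (d.chart i ∘ Opens.inclusion (hle i)) 2 (R i τ) τ) atTop (𝓝 0) := fun i ↦
    tendsto_of_tendsto_of_tendsto_of_le_of_le tendsto_const_nhds (hgrow i 2) (fun _ ↦ zero_le)
      fun τ ↦ hdev i 2 (R i τ) τ
  -- (3) separation of the near zones (same world-tubes)
  have hdisj : ∀ ρ : ℝ, ∃ τ : ℝ, Pairwise (Function.onFun Disjoint fun i ↦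
      (d.chart i ∘ Opens.inclusion (hle i)) ''
        (boostedKerrBackground (d.motion i).1 (d.motion i).2 (M i) (a i)).truncLateRegion τ ρ) := by
    intro ρ
    obtain ⟨τ, hτ⟩ := d.exists_pairwise_disjoint ρ
    have e : (fun i ↦ (d.chart i ∘ Opens.inclusion (hle i)) ''
        (boostedKerrBackground (d.motion i).1 (d.motion i).2 (M i) (a i)).truncLateRegion τ ρ) =
        fun i ↦ d.chart i ''
          (boostedKerrBackground (d.motion i).1 (d.motion i).2 (d.mass i) (d.spin i)).truncLateRegion
            τ ρ :=
      funext fun i ↦ relabelRechart_image_truncLateRegion _ _ _ _ _ _ (hle i) (hge i) (d.chart i)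
        (hrad i) τ ρ
    refine ⟨τ, ?_⟩
    rw [e]
    exact hτ
  -- (4) the flat-domain clause (same excision radii, `r_{aᵢ} = r_{d.spin i}`)
  have hfd : {x : E4 | d.τ₀ < x 0 ∧ ∀ i : Fin d.N, d.excision i (x 0) <
      Kerr.radius (a i) (poincareInv (d.motion i).1 (d.motion i).2 x)} ⊆ (d.flatDomain : Set E4) :=
    fun x hx ↦ d.setOf_lt_excision_subset_flatDomain ⟨hx.1, fun i ↦ (hx.2 i).trans_eq (hradx i _)⟩
  -- (5) the covering clause at `d.τ₀` (same late images and initial slabs)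
  have hcovd : O \ ((⋃ i, (d.chart i ∘ Opens.inclusion (hle i)) ''
        (boostedKerrBackground (d.motion i).1 (d.motion i).2 (M i) (a i)).lateRegion d.τ₀) ∪
        d.flatChart '' (Minkowski.backgroundOn d.flatDomain).lateRegion d.τ₀) ⊆
      𝒟.metric.causalPast 𝒟.timeOrientation ((⋃ i, (d.chart i ∘ Opens.inclusion (hle i)) ''
        (boostedKerrBackground (d.motion i).1 (d.motion i).2 (M i) (a i)).timeSlab d.τ₀) ∪
        d.flatChart '' (Minkowski.backgroundOn d.flatDomain).timeSlab d.τ₀) := by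
    have e1 : (⋃ i, (d.chart i ∘ Opens.inclusion (hle i)) ''
          (boostedKerrBackground (d.motion i).1 (d.motion i).2 (M i) (a i)).lateRegion d.τ₀) =
        ⋃ i, d.chart i ''
          (boostedKerrBackground (d.motion i).1 (d.motion i).2 (d.mass i) (d.spin i)).lateRegion d.τ₀ :=
      iUnion_congr fun i ↦ relabelRechart_image_lateRegion _ _ _ _ _ _ (hle i) (hge i) (d.chart i) d.τ₀
    have e2 : (⋃ i, (d.chart i ∘ Opens.inclusion (hle i)) ''
          (boostedKerrBackground (d.motion i).1 (d.motion i).2 (M i) (a i)).timeSlab d.τ₀) =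
        ⋃ i, d.chart i ''
          (boostedKerrBackground (d.motion i).1 (d.motion i).2 (d.mass i) (d.spin i)).timeSlab d.τ₀ :=
      iUnion_congr fun i ↦ relabelRechart_image_timeSlab _ _ _ _ _ _ (hle i) (hge i) (d.chart i) d.τ₀
    rw [e1, e2]
    exact d.diff_subset_causalPast
  -- (6) the covector orientation clause on the re-typed slabs (chain rule along the inclusion)
  have hcovec : ∀ (i : Fin d.N) (ρ : ℝ), ∀ᶠ τ in atTop, ∀ x ∈ (boostedKerrBackground (d.motion i).1
      (d.motion i).2 (M i) (a i)).truncTimeSlab ρ τ, ∀ w : E4,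
      𝒟.timeOrientation.IsFutureDirected
        (mfderiv 𝓘(ℝ, E4) (𝓡 4) (d.chart i ∘ Opens.inclusion (hle i)) x w) →
        0 < ((d.motion i).1 : E4 ≃L[ℝ] E4).symm w 0 := by
    intro i ρ
    filter_upwards [hcov i ρ] with τ hτ x hx w hw
    obtain ⟨hx₁, hx₂⟩ := hx
    have h2 : Kerr.radius (a i) (poincareInv (d.motion i).1 (d.motion i).2 x.1) ≤ ρ := hx₂
    have h3 : poincareInv (d.motion i).1 (d.motion i).2 x.1 0 = τ := hx₁
    rw [hrad i] at h2
    have hmem : Opens.inclusion (hle i) x ∈ (d.background i).truncTimeSlab ρ τ := ⟨h3, h2⟩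
    have hdiff : MDifferentiableAt 𝓘(ℝ, E4) (𝓡 4) (d.chart i) (Opens.inclusion (hle i) x) :=
      ((d.isLateChart i).contMDiff _).mdifferentiableAt (by simp)
    rw [restrictionRechart_mfderiv_comp_inclusion_apply (hle i) x hdiff w] at hw
    exact hτ (Opens.inclusion (hle i) x) hmem w hw
  -- (7) honest radii with respect to the relabelled parameters (`r₊(Mᵢ, aᵢ) = r₊(d.mass i, d.spin i)`)
  have hR' : ∀ i : Fin d.N, Tendsto (R i) atTop atTop ∧
      ∀ τ : ℝ, max (Kerr.rPlus (M i) (a i)) 0 + 1 ≤ R i τ :=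
    fun i ↦ ⟨(hR i).1, fun τ ↦ by rw [hrp i]; exact (hR i).2 τ⟩
  -- the relabelled system
  let d' : FinalStateDecomposition 𝒟.toSpacetime O 2 :=
    { N := d.N
      mass := M
      spin := a
      mass_pos := fun i ↦ (hsub i).1
      abs_spin_le_mass := fun i ↦ (hsub i).2.le
      motion := d.motion
      τ₀ := d.τ₀
      chart := fun i ↦ d.chart i ∘ Opens.inclusion (hle i)
      isLateChart := hlate
      tendsto_truncDeviationCk := htrunc
      exists_pairwise_disjoint := hdisj
      excision := d.excision
      tendsto_excision_div := d.tendsto_excision_div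
      flatDomain := d.flatDomain
      setOf_lt_excision_subset_flatDomain := hfd
      flatChart := d.flatChart
      isLateChart_flat := d.isLateChart_flat
      tendsto_deviationCk_flat := hflat 2
      diff_subset_causalPast := hcovd }
  -- its derived sets are those of the reference system
  have hch : d'.charted = d.charted :=
    congrArg (d.flatChart '' (Minkowski.backgroundOn d.flatDomain).lateRegion d.τ₀ ∪ ·)
      (iUnion_congr fun i ↦
        relabelRechart_image_lateRegion _ _ _ _ _ _ (hle i) (hge i) (d.chart i) d.τ₀)
  have hcl : ∀ τ₂ : ℝ, Summit.FinalStateConjecture.certifiedLate d' R τ₂ = d.certifiedLate R τ₂ :=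
    fun τ₂ ↦ congrArg (d.flatChart '' (Minkowski.backgroundOn d.flatDomain).lateRegion τ₂ ∪ ·)
      (iUnion_congr fun i ↦ relabelRechart_image_certified _ _ _ _ _ _ (hle i) (hge i) (d.chart i)
        (hrad i) (R i) τ₂)
  have hcs : ∀ τ₂ : ℝ, Summit.FinalStateConjecture.certifiedSlab d' R τ₂ = d.certifiedSlab R τ₂ :=
    fun τ₂ ↦ congrArg (d.flatChart '' (Minkowski.backgroundOn d.flatDomain).timeSlab τ₂ ∪ ·)
      (iUnion_congr fun i ↦ relabelRechart_image_truncTimeSlab _ _ _ _ _ _ (hle i) (hge i) (d.chart i)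
        (hrad i) (R i τ₂) τ₂)
  refine ⟨O, d', ?_⟩
  rw [isSettledSystem_iff]
  refine ⟨fun i ↦ (hsub i).2, ?_, hrays, ⟨R, hR', hgrow', fun τ₂ hτ₂ ↦ ?_⟩, horth, hcovec, hflat0⟩
  · rw [hch]
    exact hO
  · rw [hcl τ₂, hcs τ₂]
    exact hexh τ₂ hτ₂

end Summit.FinalStateConjecture.FinalStateConjecture.Theorems

end
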